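import Summits.Ventures.Crystal3D.Theorems.StickyWulffConstantTextureBuildHealSurgery
import HarnessLib

/-!
# TB-1 brick L-HEAL, family form of the site surgery: ONE healed packing occupying the prescribed site sets of MANY grains (windows more than `4` apart)
# (lane T, crux `TextureLiminfV5`, stmt-Ventures-23912; memo HOME/wulff-p2/g24/HEAL-g24.md §4 (a))

HONEST FRAMING. Venture `Summits/Ventures/Crystal3D` (cell `crystal3d-full`), route `route-Ventures-StickyWulffConstant`, helper `--supports` the
law-v5 crux `TextureLiminfV5` (stmt-Ventures-23912).  Pure finite combinatorics over '…TextureBuildHealSurgery' (census-free, standard axioms).  Nothing about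
any cover or texture is claimed; F-C1 not moved.

WHY.  `CoverH` wants ONE healed packing `x'` for the whole cluster; the constructor's site windows `W f` (one per grain `f : ι`: the union of the plate windows on
grain `f`'s side of its walls, each a finite set of sites of the grain lattice `S_f`) are pairwise more than `4` apart (wall slabs have thickness `h + 2R₀ > 4`).
`exists_site_heal` ('…HealSurgery') is the one-window statement; this file is the simultaneous one, with the bill split per window:

* `cdeg_biUnion_eq_sum` — the contact degree towards a pairwise disjoint union is the sum of the degrees;
* **`exists_site_heal_family`** — `x` a unit packing, `S_f` moved Barlow stackings, finite `W f ⊆ S_f` pairwise `> 4` apart; `R f` := blockers of `W f` (off-`S_f`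
  balls within `< 1` of a site of `W f`), `V f` := vacant sites of `W f` (both by defining membership).  Then `(range x ∖ ⋃R) ∪ ⋃V` is a unit packing `x'`,
  every site of every `W f` is a ball of `x'`, `range x'` is described exactly, `N ≤ N' + Σ_f #(R f)`, and
  `6N' − b(x') ≤ 6N − b(x) − Σ_f hd_X(R f) + ½·Σ_f [Σ_{V f} ab_f + Σ_{K ∩ S_f touching R f} ab_f + cross(K ∖ S_f, R f)]`,
  `K := range x ∖ ⋃R`, `ab_f := abandoned S_f K (⋃V)` — the kissing bound at each kept ball, charged to the unique window it touches.
-/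

noncomputable section

namespace Summit.Ventures.Crystal3D.Theorems

open Finset Summit.Ventures.Crystal3D
open Literature.MathematicalPhysics.StatisticalMechanics (IsHaggSeq contactDeficiency)
open Summit.Ventures.Crystal3D.Cruxes.TextureLiminf.TexShadow (E3 stacking one_le_dist_of_mem_stacking)

/-- The contact degree towards a pairwise disjoint finite union is the sum of the contact degrees. -/
theorem cdeg_biUnion_eq_sum {ι : Type*} [DecidableEq E3] (T : Finset ι) (A : ι → Finset E3)
    (hdisj : ∀ i ∈ T, ∀ j ∈ T, i ≠ j → Disjoint (A i) (A j)) (b : E3) :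
    cdeg (T.biUnion A) b = ∑ i ∈ T, cdeg (A i) b := by
  classical
  unfold cdeg
  rw [Finset.filter_biUnion, Finset.card_biUnion]
  intro i hi j hj hij
  exact Finset.disjoint_filter_filter (hdisj i hi j hj hij)

section Family

variable {N : ℕ} {x : Fin N → E3} {ι : Type*} [Fintype ι]
  {L : ι → (E3 ≃ₗᵢ[ℝ] E3)} {s : ι → E3} {σ : ι → ℤ → ℤ}

open scoped Classical in
/-- **THE SITE SURGERY, FAMILY FORM.**  See the module docstring. -/
theorem exists_site_heal_family (hx : IsUnitPacking x) (hσ : ∀ f, IsHaggSeq (σ f)) (W R V : ι → Finset E3)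
    (hW : ∀ f, ∀ w ∈ W f, w ∈ stacking (L f) (s f) (σ f))
    (hRdef : ∀ f a, a ∈ R f ↔ a ∈ Set.range x ∧ a ∉ stacking (L f) (s f) (σ f) ∧ ∃ w ∈ W f, dist a w < 1)
    (hVdef : ∀ f v, v ∈ V f ↔ v ∈ W f ∧ v ∉ Set.range x)
    (hfar : ∀ f g, f ≠ g → ∀ w ∈ W f, ∀ w' ∈ W g, 4 < dist w w') :
    ∃ (N' : ℕ) (x' : Fin N' → E3), IsUnitPacking x' ∧
      Finset.univ.image x' = (Finset.univ.image x \ Finset.univ.biUnion R) ∪ Finset.univ.biUnion V ∧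
      (∀ f, ∀ w ∈ W f, w ∈ Set.range x') ∧
      (∀ y, y ∈ Set.range x' ↔
        (y ∈ Set.range x ∧ ∀ f, y ∈ stacking (L f) (s f) (σ f) ∨ ∀ w ∈ W f, 1 ≤ dist y w) ∨ ∃ f, y ∈ W f) ∧
      6 * (N' : ℝ) - (numContacts x' : ℝ) ≤ 6 * (N : ℝ) - (numContacts x : ℝ) -
        ∑ f, ∑ a ∈ R f, halfDefect (Finset.univ.image x) a +
        (∑ f, ((∑ v ∈ V f, (abandoned (stacking (L f) (s f) (σ f))
              (Finset.univ.image x \ Finset.univ.biUnion R) (Finset.univ.biUnion V) v : ℝ)) +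
          ∑ b ∈ (Finset.univ.image x \ Finset.univ.biUnion R).filter
              (fun b => b ∈ stacking (L f) (s f) (σ f) ∧ ∃ a ∈ R f, dist b a = 1),
            (abandoned (stacking (L f) (s f) (σ f)) (Finset.univ.image x \ Finset.univ.biUnion R) (Finset.univ.biUnion V) b : ℝ) +
          (crossCount ((Finset.univ.image x \ Finset.univ.biUnion R).filter fun b => b ∉ stacking (L f) (s f) (σ f)) (R f) : ℝ))) / 2 ∧
      N ≤ N' + ∑ f, (R f).card := by
  classical
  set X : Finset E3 := Finset.univ.image x with hXdef
  set Rall : Finset E3 := Finset.univ.biUnion R with hRall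
  set Vall : Finset E3 := Finset.univ.biUnion V with hVall
  set K : Finset E3 := X \ Rall with hKdef
  let S : ι → Set E3 := fun f => stacking (L f) (s f) (σ f)
  have hXsep := image_sep hx
  have hmemX : ∀ {a : E3}, a ∈ X ↔ a ∈ Set.range x := fun {a} => by
    rw [hXdef]; exact mem_image_univ_iff_mem_range
  -- basic facts on the windows
  have hVW : ∀ f, ∀ v ∈ V f, v ∈ W f := fun f v hv => ((hVdef f v).1 hv).1
  have hVS : ∀ f, ∀ v ∈ V f, v ∈ S f := fun f v hv => hW f v (hVW f v hv)
  have hRnear : ∀ f, ∀ a ∈ R f, ∃ w ∈ W f, dist a w < 1 := fun f a ha => ((hRdef f a).1 ha).2.2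
  have hRX : ∀ f, R f ⊆ X := fun f a ha => hmemX.2 ((hRdef f a).1 ha).1
  have hRallX : Rall ⊆ X := Finset.biUnion_subset.2 fun f _ => hRX f
  -- farness consequences
  have hRfar : ∀ f g, f ≠ g → ∀ a ∈ R f, ∀ a' ∈ R g, 2 < dist a a' := by
    intro f g hfg a ha a' ha'
    obtain ⟨w, hw, hd⟩ := hRnear f a ha
    obtain ⟨w', hw', hd'⟩ := hRnear g a' ha'
    have h4 := hfar f g hfg w hw w' hw'
    have := dist_triangle4 w a a' w'
    rw [dist_comm w a] at this
    linarith
  have hRdisj : ∀ f ∈ (Finset.univ : Finset ι), ∀ g ∈ (Finset.univ : Finset ι), f ≠ g → Disjoint (R f) (R g) := by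
    intro f _ g _ hfg
    rw [Finset.disjoint_left]
    intro a ha ha'
    have := hRfar f g hfg a ha a ha'
    rw [dist_self] at this
    linarith
  have hVdisj : ∀ f ∈ (Finset.univ : Finset ι), ∀ g ∈ (Finset.univ : Finset ι), f ≠ g → Disjoint (V f) (V g) := by
    intro f _ g _ hfg
    rw [Finset.disjoint_left]
    intro v hv hv'
    have := hfar f g hfg v (hVW f v hv) v (hVW g v hv')
    rw [dist_self] at this
    linarith
  have hmemRall : ∀ {a : E3}, a ∈ Rall ↔ ∃ f, a ∈ R f := fun {a} => by
    rw [hRall, Finset.mem_biUnion]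
    exact ⟨fun ⟨f, _, h⟩ => ⟨f, h⟩, fun ⟨f, h⟩ => ⟨f, Finset.mem_univ _, h⟩⟩
  have hmemVall : ∀ {v : E3}, v ∈ Vall ↔ ∃ f, v ∈ V f := fun {v} => by
    rw [hVall, Finset.mem_biUnion]
    exact ⟨fun ⟨f, _, h⟩ => ⟨f, h⟩, fun ⟨f, h⟩ => ⟨f, Finset.mem_univ _, h⟩⟩
  have hVK : Disjoint Vall K := by
    rw [Finset.disjoint_left]
    intro v hv hvK
    obtain ⟨f, hvf⟩ := hmemVall.1 hv
    exact ((hVdef f v).1 hvf).2 (hmemX.1 (Finset.mem_sdiff.1 hvK).1)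
  -- the new point set is `1`-separated
  have hsep : ∀ p ∈ K ∪ Vall, ∀ q ∈ K ∪ Vall, p ≠ q → 1 ≤ dist p q := by
    have hmixed : ∀ a ∈ K, ∀ v ∈ Vall, 1 ≤ dist a v := by
      intro a ha v hv
      obtain ⟨haX, haR⟩ := Finset.mem_sdiff.1 ha
      obtain ⟨f, hvf⟩ := hmemVall.1 hv
      by_cases haS : a ∈ S f
      · have hne : a ≠ v := fun h => ((hVdef f v).1 hvf).2 (hmemX.1 (h ▸ haX))
        exact one_le_dist_of_mem_stacking (hσ f) haS (hVS f v hvf) hne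
      · by_contra hlt
        push Not at hlt
        exact haR (hmemRall.2 ⟨f, (hRdef f a).2 ⟨hmemX.1 haX, haS, v, hVW f v hvf, hlt⟩⟩)
    have hVV : ∀ p ∈ Vall, ∀ q ∈ Vall, p ≠ q → 1 ≤ dist p q := by
      intro p hp q hq hpq
      obtain ⟨f, hpf⟩ := hmemVall.1 hp
      obtain ⟨g, hqg⟩ := hmemVall.1 hq
      by_cases hfg : f = g
      · subst hfg
        exact one_le_dist_of_mem_stacking (hσ f) (hVS f p hpf) (hVS f q hqg) hpq
      · have := hfar f g hfg p (hVW f p hpf) q (hVW g q hqg)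
        linarith
    intro p hp q hq hpq
    rcases Finset.mem_union.1 hp with hpK | hpV <;> rcases Finset.mem_union.1 hq with hqK | hqV
    · exact hXsep p (Finset.mem_sdiff.1 hpK).1 q (Finset.mem_sdiff.1 hqK).1 hpq
    · exact hmixed p hpK q hqV
    · rw [dist_comm]; exact hmixed q hqK p hpV
    · exact hVV p hpV q hqV hpq
  obtain ⟨x', hx', himg⟩ := exists_enum_of_separated (K ∪ Vall) hsep
  have hmem' : ∀ {a : E3}, a ∈ Set.range x' ↔ a ∈ K ∪ Vall := fun {a} => by
    have h := (mem_image_univ_iff_mem_range (f := x') (b := a)).symm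
    rw [himg] at h
    exact h
  refine ⟨(K ∪ Vall).card, x', hx', himg, ?_, ?_, ?_, ?_⟩
  · -- every prescribed site is a ball afterwards
    intro f w hw
    rw [hmem', Finset.mem_union]
    by_cases hwx : w ∈ Set.range x
    · refine Or.inl (Finset.mem_sdiff.2 ⟨hmemX.2 hwx, fun hwR => ?_⟩)
      obtain ⟨g, hwg⟩ := hmemRall.1 hwR
      obtain ⟨-, hwS, w', hw', hd⟩ := (hRdef g w).1 hwg
      by_cases hgf : g = f
      · subst hgf; exact hwS (hW g w hw)
      · have := hfar f g (Ne.symm hgf) w hw w' hw'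
        linarith
    · exact Or.inr (hmemVall.2 ⟨f, (hVdef f w).2 ⟨hw, hwx⟩⟩)
  · -- the new range, exactly
    intro y
    rw [hmem', Finset.mem_union, Finset.mem_sdiff, hmemX, hmemRall, hmemVall]
    constructor
    · rintro (⟨hyx, hyR⟩ | ⟨f, hyV⟩)
      · refine Or.inl ⟨hyx, fun f => ?_⟩
        by_cases hyS : y ∈ S f
        · exact Or.inl hyS
        · refine Or.inr fun w hw => ?_
          by_contra hlt
          push Not at hlt
          exact hyR ⟨f, (hRdef f y).2 ⟨hyx, hyS, w, hw, hlt⟩⟩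
      · exact Or.inr ⟨f, hVW f y hyV⟩
    · rintro (⟨hyx, hyall⟩ | ⟨f, hyW⟩)
      · refine Or.inl ⟨hyx, ?_⟩
        rintro ⟨f, hyf⟩
        obtain ⟨-, hyS, w, hw, hlt⟩ := (hRdef f y).1 hyf
        rcases hyall f with h | h
        · exact hyS h
        · exact absurd (h w hw) (not_le.2 hlt)
      · by_cases hyx : y ∈ Set.range x
        · refine Or.inl ⟨hyx, ?_⟩
          rintro ⟨g, hyg⟩
          obtain ⟨-, hyS, w, hw, hlt⟩ := (hRdef g y).1 hyg
          by_cases hgf : g = f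
          · subst hgf; exact hyS (hW g y hyW)
          · have := hfar f g (Ne.symm hgf) y hyW w hw
            linarith
        · exact Or.inr ⟨f, (hVdef f y).2 ⟨hyW, hyx⟩⟩
  · -- the bill
    rw [← contactDeficiency_image_eq x hx.injective, ← contactDeficiency_image_eq x' hx'.injective, himg,
      contactDeficiency_exchange_eq hRallX hVK]
    have hXK : X \ K = Rall := Finset.sdiff_sdiff_eq_self hRallX
    have hKX : K ⊆ X := Finset.sdiff_subset
    -- (1) removal terms: `½·cross(K, Rall) − Σ hd`
    have hrem : ∑ a ∈ Rall, ((cdeg X a : ℝ) - (cdeg Rall a : ℝ) / 2 - 6) =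
        (crossCount K Rall : ℝ) / 2 - ∑ f, ∑ a ∈ R f, halfDefect X a := by
      rw [← Finset.sum_biUnion hRdisj, crossCount_comm, crossCount_eq_sum, Nat.cast_sum, Finset.sum_div, ← Finset.sum_sub_distrib]
      refine Finset.sum_congr rfl fun a _ => ?_
      have hdeg : (cdeg X a : ℝ) = (cdeg K a : ℝ) + (cdeg Rall a : ℝ) := by
        have := cdeg_eq_add_sdiff hKX a; rw [hXK] at this; exact_mod_cast this
      have hKa : ((K.filter fun q => dist a q = 1).card : ℕ) = cdeg K a := rfl
      rw [hKa]
      unfold halfDefect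
      rw [hdeg]; ring
    -- (2) refill terms, window by window: `≤ ½·Σ_f Σ_{V f} ab_f − ½·cross(K, Vall)`
    have hrefill : ∑ v ∈ Vall, ((6 : ℝ) - (cdeg K v : ℝ) - (cdeg Vall v : ℝ) / 2) ≤
        (∑ f, ∑ v ∈ V f, (abandoned (S f) K Vall v : ℝ)) / 2 - (crossCount K Vall : ℝ) / 2 := by
      have hcross : (crossCount K Vall : ℝ) = ∑ f, ∑ v ∈ V f, (cdeg K v : ℝ) := by
        rw [crossCount_comm, crossCount_eq_sum, Nat.cast_sum, ← Finset.sum_biUnion hVdisj]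
        rfl
      have hL : ∑ v ∈ Vall, ((6 : ℝ) - (cdeg K v : ℝ) - (cdeg Vall v : ℝ) / 2) =
          ∑ f, ∑ v ∈ V f, ((6 : ℝ) - (cdeg K v : ℝ) - (cdeg Vall v : ℝ) / 2) := by
        show ∑ v ∈ Finset.univ.biUnion V, _ = _
        exact Finset.sum_biUnion hVdisj
      rw [hcross, hL, Finset.sum_div, Finset.sum_div, ← Finset.sum_sub_distrib]
      refine Finset.sum_le_sum fun f _ => ?_
      rw [Finset.sum_div, Finset.sum_div, ← Finset.sum_sub_distrib]
      refine Finset.sum_le_sum fun v hv => ?_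
      have h12 : (12 : ℝ) ≤ (cdeg K v : ℝ) + (cdeg Vall v : ℝ) + (abandoned (S f) K Vall v : ℝ) := by
        exact_mod_cast twelve_le_cdeg_add_cdeg_add_abandoned (hσ f) (hVS f v hv) K Vall
      linarith
    -- (3) kissing, ball by ball, charged to the unique window the ball touches
    have hkiss : (crossCount K Rall : ℝ) ≤ (crossCount K Vall : ℝ) +
        ∑ f, ((∑ b ∈ K.filter (fun b => b ∈ S f ∧ ∃ a ∈ R f, dist b a = 1), (abandoned (S f) K Vall b : ℝ)) +
          (crossCount (K.filter fun b => b ∉ S f) (R f) : ℝ)) := by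
      -- everything as sums over `b ∈ K`
      have hL : (crossCount K Rall : ℝ) = ∑ b ∈ K, ∑ f, (cdeg (R f) b : ℝ) := by
        rw [crossCount_eq_sum, Nat.cast_sum]
        refine Finset.sum_congr rfl fun b _ => ?_
        have : (Rall.filter fun q => dist b q = 1).card = cdeg Rall b := rfl
        rw [this, hRall, cdeg_biUnion_eq_sum Finset.univ R hRdisj b, Nat.cast_sum]
      have hV' : (crossCount K Vall : ℝ) = ∑ b ∈ K, (cdeg Vall b : ℝ) := by
        rw [crossCount_eq_sum, Nat.cast_sum]; rfl
      have hB : ∀ f, (∑ b ∈ K.filter (fun b => b ∈ S f ∧ ∃ a ∈ R f, dist b a = 1), (abandoned (S f) K Vall b : ℝ)) =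
          ∑ b ∈ K, if (b ∈ S f ∧ ∃ a ∈ R f, dist b a = 1) then (abandoned (S f) K Vall b : ℝ) else 0 := fun f =>
        Finset.sum_filter _ _
      have hC : ∀ f, (crossCount (K.filter fun b => b ∉ S f) (R f) : ℝ) = ∑ b ∈ K, if b ∉ S f then (cdeg (R f) b : ℝ) else 0 := by
        intro f
        rw [crossCount_eq_sum, Nat.cast_sum, Finset.sum_filter]
        rfl
      suffices hper : ∀ b ∈ K, ∑ f, (cdeg (R f) b : ℝ) ≤ (cdeg Vall b : ℝ) +
          ∑ f, ((if (b ∈ S f ∧ ∃ a ∈ R f, dist b a = 1) then (abandoned (S f) K Vall b : ℝ) else 0) +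
            (if b ∉ S f then (cdeg (R f) b : ℝ) else 0)) by
        calc (crossCount K Rall : ℝ) = ∑ b ∈ K, ∑ f, (cdeg (R f) b : ℝ) := hL
          _ ≤ ∑ b ∈ K, ((cdeg Vall b : ℝ) + ∑ f, ((if (b ∈ S f ∧ ∃ a ∈ R f, dist b a = 1) then (abandoned (S f) K Vall b : ℝ) else 0) +
              (if b ∉ S f then (cdeg (R f) b : ℝ) else 0))) := Finset.sum_le_sum hper
          _ = (crossCount K Vall : ℝ) + ∑ f, ∑ b ∈ K, ((if (b ∈ S f ∧ ∃ a ∈ R f, dist b a = 1) then (abandoned (S f) K Vall b : ℝ) else 0) +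
              (if b ∉ S f then (cdeg (R f) b : ℝ) else 0)) := by
            rw [Finset.sum_add_distrib, hV', Finset.sum_comm]
          _ = _ := by
            congr 1
            refine Finset.sum_congr rfl fun f _ => ?_
            rw [Finset.sum_add_distrib, hB f, hC f]
      intro b hb
      -- per ball `b ∈ K`
      have hnonneg : ∀ f, (0 : ℝ) ≤ (if (b ∈ S f ∧ ∃ a ∈ R f, dist b a = 1) then (abandoned (S f) K Vall b : ℝ) else 0) +
          (if b ∉ S f then (cdeg (R f) b : ℝ) else 0) := by
        intro f
        have h1 : (0 : ℝ) ≤ (if (b ∈ S f ∧ ∃ a ∈ R f, dist b a = 1) then (abandoned (S f) K Vall b : ℝ) else 0) := by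
          split_ifs <;> first | exact le_rfl | exact Nat.cast_nonneg _
        have h2 : (0 : ℝ) ≤ (if b ∉ S f then (cdeg (R f) b : ℝ) else 0) := by
          split_ifs <;> first | exact le_rfl | exact Nat.cast_nonneg _
        linarith
      have hV0 : (0 : ℝ) ≤ (cdeg Vall b : ℝ) := Nat.cast_nonneg _
      have hzero : ∀ f, (¬ ∃ a ∈ R f, dist b a = 1) → cdeg (R f) b = 0 := by
        intro f hf
        unfold cdeg
        rw [Finset.card_eq_zero, Finset.filter_eq_empty_iff]
        intro a ha hd
        exact hf ⟨a, ha, hd⟩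
      by_cases htouch : ∃ f, ∃ a ∈ R f, dist b a = 1
      · obtain ⟨f₀, a₀, ha₀, hda₀⟩ := htouch
        -- no other window is touched
        have hother : ∀ g, g ≠ f₀ → cdeg (R g) b = 0 := by
          intro g hg
          refine hzero g ?_
          rintro ⟨a, ha, hda⟩
          have h2 := hRfar f₀ g (Ne.symm hg) a₀ ha₀ a ha
          have := dist_triangle a₀ b a
          rw [dist_comm a₀ b, hda₀, hda] at this
          linarith
        have hsum : ∑ f, (cdeg (R f) b : ℝ) = (cdeg (R f₀) b : ℝ) := by
          rw [Finset.sum_eq_single f₀]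
          · intro g _ hg
            rw [hother g hg, Nat.cast_zero]
          · intro h; exact absurd (Finset.mem_univ f₀) h
        rw [hsum]
        have hle := Finset.single_le_sum (f := fun f => (if (b ∈ S f ∧ ∃ a ∈ R f, dist b a = 1) then
            (abandoned (S f) K Vall b : ℝ) else 0) + (if b ∉ S f then (cdeg (R f) b : ℝ) else 0))
          (fun f _ => hnonneg f) (Finset.mem_univ f₀)
        by_cases hbS : b ∈ S f₀
        · -- kissing at the lattice ball `b`
          have hRall_b : cdeg Rall b = cdeg (R f₀) b := by
            rw [hRall, cdeg_biUnion_eq_sum Finset.univ R hRdisj b, Finset.sum_eq_single f₀]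
            · intro g _ hg; exact hother g hg
            · intro h; exact absurd (Finset.mem_univ f₀) h
          have hdeg : cdeg X b = cdeg K b + cdeg Rall b := by
            have := cdeg_eq_add_sdiff hKX b; rw [hXK] at this; exact this
          have h12X := cdeg_le_twelve X hXsep b
          have h12S : 12 ≤ cdeg K b + cdeg Vall b + abandoned (S f₀) K Vall b :=
            twelve_le_cdeg_add_cdeg_add_abandoned (hσ f₀) hbS K Vall
          have hkey : cdeg (R f₀) b ≤ cdeg Vall b + abandoned (S f₀) K Vall b := by omega
          have hkey' : (cdeg (R f₀) b : ℝ) ≤ (cdeg Vall b : ℝ) + (abandoned (S f₀) K Vall b : ℝ) := by exact_mod_cast hkey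
          have hterm : (if (b ∈ S f₀ ∧ ∃ a ∈ R f₀, dist b a = 1) then (abandoned (S f₀) K Vall b : ℝ) else 0) =
              (abandoned (S f₀) K Vall b : ℝ) := if_pos ⟨hbS, a₀, ha₀, hda₀⟩
          have hterm' : (0 : ℝ) ≤ (if b ∉ S f₀ then (cdeg (R f₀) b : ℝ) else 0) := by
            rw [if_neg (not_not.2 hbS)]
          simp only [hterm] at hle
          linarith
        · have hterm : (if b ∉ S f₀ then (cdeg (R f₀) b : ℝ) else 0) = (cdeg (R f₀) b : ℝ) := if_pos hbS
          have hterm' : (0 : ℝ) ≤ (if (b ∈ S f₀ ∧ ∃ a ∈ R f₀, dist b a = 1) then (abandoned (S f₀) K Vall b : ℝ) else 0) := by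
            rw [if_neg (fun h => hbS h.1)]
          simp only [hterm] at hle
          linarith
      · push Not at htouch
        have hsum : ∑ f, (cdeg (R f) b : ℝ) = 0 :=
          Finset.sum_eq_zero fun f _ => by rw [hzero f (fun ⟨a, ha, hd⟩ => htouch f a ha hd), Nat.cast_zero]
        rw [hsum]
        have := Finset.sum_nonneg fun f (_ : f ∈ (Finset.univ : Finset ι)) => hnonneg f
        linarith
    -- (4) assemble
    have hsplit : ∑ f, ((∑ v ∈ V f, (abandoned (S f) K Vall v : ℝ)) +
        (∑ b ∈ K.filter (fun b => b ∈ S f ∧ ∃ a ∈ R f, dist b a = 1), (abandoned (S f) K Vall b : ℝ)) +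
        (crossCount (K.filter fun b => b ∉ S f) (R f) : ℝ)) =
        (∑ f, ∑ v ∈ V f, (abandoned (S f) K Vall v : ℝ)) +
        ∑ f, ((∑ b ∈ K.filter (fun b => b ∈ S f ∧ ∃ a ∈ R f, dist b a = 1), (abandoned (S f) K Vall b : ℝ)) +
          (crossCount (K.filter fun b => b ∉ S f) (R f) : ℝ)) := by
      rw [← Finset.sum_add_distrib]
      refine Finset.sum_congr rfl fun f _ => by ring
    rw [hrem, hsplit]
    linarith
  · -- count
    have hN : N = X.card := (card_image_univ_eq x hx.injective).symm
    have h1 : K.card + Rall.card = X.card := Finset.card_sdiff_add_card_eq_card hRallX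
    have h2 : K.card ≤ (K ∪ Vall).card := Finset.card_le_card Finset.subset_union_left
    have h3 : Rall.card ≤ ∑ f, (R f).card := Finset.card_biUnion_le
    omega

end Family

end Summit.Ventures.Crystal3D.Theorems

end
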